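import Literature.Barriers.RiemannHypothesis.SubsetPrimeTowers
import Literature.NumberTheory.LFunctions.LandauRealZero
import Literature.NumberTheory.LFunctions.ZetaLogDerivRH
import Literature.NumberTheory.LFunctions.ZetaRealAxis
import Literature.NumberTheory.BeurlingPrimes.IntegerContinuation
import Literature.NumberTheory.BeurlingPrimes.OneLine

/-!
# Sub-sequences of the primes cannot sink REAL-ZERO-FREE criteria unless RH fails (barrier record S3♯, residual r3a)

A BARRIER RECORD completing residual (r3) «non-real planted zeros» of S3♯
(`Literature/Barriers/RiemannHypothesis/SubsetPrimeTowers.lean`, `subPrimeFiniteTowerBlind_holds`), (s)-class,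
0 toward RH: an INSTRUMENT, not a route.  Everything here is PROVED (no named fact, no sorry); tree objects are
cited BY NAME, nothing is restated.
## The barrier sentence
For every window exponent `θ ∈ [0, 1/2)`: a Beurling prime system `P` which is a multiplicity-one sub-sequence of
the rational primes (`P.prime j = q_{f j}`, `f` strictly increasing) with `N_P(x) = a x + O(x^θ)`, `a > 0`
(`BeurlingPrimes.IntErrorLE`), a holomorphic continuation `Z` of `ζ_P` to `{Re s > θ} ∖ {1}`
(`BeurlingPrimes.IsZetaContinuation`), NO REAL ZERO of `Z` on `(1/2, 1)`, and yet a zero `ρ` with `1/2 < Re ρ < 1`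
— EXISTS IF AND ONLY IF RH FAILS (`subPrimeBlindRealZeroFree_iff_not_riemannHypothesis`).  So every S3♯-type
witness (a sub-ℙ deletion system planting a zero inside the window, as in the parent record) is DEFEATED by any
criterion carrying the hypothesis «no real zeros in `(1/2, 1)`» — which `ζ` itself satisfies (`ζ(σ) < 0` on `(0,1)`,
`riemannZeta_ofReal_ne_zero_of_pos_of_lt_one`) — unless RH is false, in which case `P = ℙ` is the witness.  This
PRICES at birth the class of would-be criteria «sub-ℙ support + counting below `1/2` + continuation + real-zero-free
⟹ zero-free in `1/2 < Re s < 1`»: no deletion witness can refute one; at `P = ℙ` it is RH.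
## Proof = Landau positivity for pure deletions (`subPrimeRealZeroDominance_holds`)
Under RH, for such `P`, `Z` and a zero `ρ` with `1/2 < Re ρ < 1`: `E := Z/ζ` (value `a` at `s = 1`:
`(s−1)Z(s) → a` by `MontgomeryVaughan2007_zetaContinuation_holds` + `IsZetaContinuation.eqOn`, `(s−1)ζ(s) → 1` by
`riemannZeta_residue_one`) is holomorphic on `Re s > 1/2` (`riemannZeta_ne_zero_of_riemannHypothesis`, removable
singularity `Complex.differentiableOn_compl_singleton_and_continuousAt_iff`), and on `Re s > 2`
`E = ζ_P/ζ = exp(−G_D)` (`zeta_div_riemannZeta_eq`: Euler products `BeurlingPrimes.zeta_eq_exp_tsum`, `zeta_ratPrimes`,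
split of `∑_p −log(1 − p^{−s})` over kept and deleted primes) where `G_D(s) = ∑_{p deleted} ∑_{k≥1} p^{−ks}/k` IS a
generalized Dirichlet series with non-negative coefficients (`genDirichlet_del_eq`, `Landau.genDirichlet`).  Landau's
theorem in the exponential-with-zeros form (`Landau.exists_real_zero_of_eqOn_cexp_neg`, MV §1.2 Thm. 1.7) gives a REAL
zero `β ∈ [Re ρ, 2]` of `E`; `β ≠ 1` since `E(1) = a > 0`, `β > 1` is impossible since there `Z = ζ_P ≠ 0`
(`BeurlingPrimes.zeta_ne_zero`); so `β < 1` and `Z(β) = ζ(β) E(β) = 0`: every zero of `Z` in the window is DOMINATED by a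
real zero (`SubPrimeRealZeroDominance`).  The ¬RH direction is `P = ℙ`, `f = id`, `Z = ζ`
(`exists_zero_half_lt_re_of_not_riemannHypothesis`), as in the parent record.

## Relations (by name)
* Parent record S3♯ `subPrimeFiniteTowerBlind_holds` (window zero planted at the REAL point `s = α` under RH) and its
  appendix `SubPrimeQuasiCriterion.forces` (`SubsetPrimeTowersQuasi.lean`); this file settles the parent header's
  residual (r3) for NON-REAL zeros: they never come alone.  Residuals (r1) bounded-error counting and (r2) infinite
  towers are catalogue text (Lagarias rigidity; finiteness by method) and are asserted nowhere here.
HONEST LABEL: barrier record, (s), 0 toward RH; nothing here bears on the truth of RH.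

## References
* H. L. Montgomery, R. C. Vaughan, *Multiplicative Number Theory I. Classical Theory*, CUP 2007: §1.2 Thm. 1.7 and
  its proof (held PDF pp. 25–26). [MontgomeryVaughan2007]
* [BrouckeDebruyneRevesz2023] F. Broucke, G. Debruyne, Sz. Gy. Révész, *Some examples of well-behaved Beurling number
  systems*, arXiv:2309.01567, Trans. AMS (2024), §5 (the parent record's witnesses).
-/

noncomputable section

open Set Complex Filter Topology

namespace Literature.Barriers.RiemannHypothesis

open Literature.NumberTheory.BeurlingPrimes Literature.NumberTheory.LFunctions

/-! ## The deleted Euler logarithm as a generalized Dirichlet series -/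

section DeletedLog

variable (f : ℕ → ℕ)

/-- Coefficients `1/k` (`k = i.2 + 1`) of the deleted Euler logarithm `G_D(s) = ∑_{p deleted} ∑_{k≥1} p^{−ks}/k`,
indexed by (deleted prime index, `k − 1`). [folklore] -/
def delCoeff (i : ↥(Set.range f)ᶜ × ℕ) : ℝ := 1 / ((i.2 : ℝ) + 1)

/-- Frequencies `k log p` of the deleted Euler logarithm. [folklore] -/
def delFreq (i : ↥(Set.range f)ᶜ × ℕ) : ℝ := ((i.2 : ℝ) + 1) * Real.log (ratPrime (i.1 : ℕ))

/-- `1/k ≥ 0`. [folklore] -/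
private theorem delCoeff_nonneg (i : ↥(Set.range f)ᶜ × ℕ) : 0 ≤ delCoeff f i := by
  unfold delCoeff; positivity

/-- `1 < q_n` in `ℝ`. [folklore] -/
private theorem one_lt_ratPrime_real (n : ℕ) : (1 : ℝ) < ratPrime n := by
  exact_mod_cast (prime_ratPrime n).one_lt

/-- `k log p ≥ 0`. [folklore] -/
private theorem delFreq_nonneg (i : ↥(Set.range f)ᶜ × ℕ) : 0 ≤ delFreq f i := by
  unfold delFreq
  exact mul_nonneg (by positivity) (Real.log_nonneg (one_lt_ratPrime_real _).le)

/-- `∑_{p deleted} ∑_k p^{−2k}/k < ∞`: absolute convergence of the deleted Euler log at `σ = 2`. [folklore] -/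
private theorem summable_del_two : Summable fun i ↦ delCoeff f i * Real.exp (-(delFreq f i * 2)) := by
  -- `q n = p_n^{−2} = exp(−2 log p_n) ≤ 1/4`
  set q : ↥(Set.range f)ᶜ → ℝ := fun n ↦ Real.exp (-(2 * Real.log (ratPrime (n : ℕ)))) with hq
  have hq0 : ∀ n, 0 ≤ q n := fun n ↦ (Real.exp_pos _).le
  have hq4 : ∀ n, q n ≤ 1 / 4 := by
    intro n
    have h2 : (2 : ℝ) ≤ ratPrime (n : ℕ) := by exact_mod_cast (prime_ratPrime (n : ℕ)).two_le
    have hlog : Real.log 2 ≤ Real.log (ratPrime (n : ℕ)) := Real.log_le_log (by norm_num) h2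
    have : q n ≤ Real.exp (-(2 * Real.log 2)) := by
      rw [hq]
      exact Real.exp_le_exp.2 (by linarith)
    refine this.trans (le_of_eq ?_)
    rw [show -(2 * Real.log 2) = Real.log ((2 : ℝ) ^ 2)⁻¹ by
      rw [Real.log_inv, Real.log_pow]; push_cast; ring, Real.exp_log (by positivity)]
    norm_num
  have hF0 : 0 ≤ fun i ↦ delCoeff f i * Real.exp (-(delFreq f i * 2)) :=
    fun i ↦ mul_nonneg (delCoeff_nonneg f i) (Real.exp_pos _).le
  -- termwise bound `F(n,k) ≤ q n * (1/4)^k`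
  have hterm : ∀ (n : ↥(Set.range f)ᶜ) (k : ℕ),
      delCoeff f (n, k) * Real.exp (-(delFreq f (n, k) * 2)) ≤ q n * (1 / 4) ^ k := by
    intro n k
    have hexp : Real.exp (-(delFreq f (n, k) * 2)) = q n ^ (k + 1) := by
      rw [hq]
      simp only [delFreq]
      rw [← Real.exp_nat_mul]
      congr 1
      push_cast
      ring
    have hcoef : delCoeff f (n, k) ≤ 1 := by
      simp only [delCoeff]
      rw [div_le_one (by positivity)]
      linarith [(Nat.cast_nonneg k : (0 : ℝ) ≤ k)]
    calc delCoeff f (n, k) * Real.exp (-(delFreq f (n, k) * 2))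
        ≤ 1 * q n ^ (k + 1) := by
          rw [hexp]
          exact mul_le_mul_of_nonneg_right hcoef (pow_nonneg (hq0 n) _)
      _ = q n * q n ^ k := by ring
      _ ≤ q n * (1 / 4) ^ k :=
          mul_le_mul_of_nonneg_left (pow_le_pow_left₀ (hq0 n) (hq4 n) k) (hq0 n)
  have hgeo : Summable fun k : ℕ ↦ (1 / 4 : ℝ) ^ k :=
    summable_geometric_of_lt_one (by norm_num) (by norm_num)
  have hinner : ∀ n : ↥(Set.range f)ᶜ, Summable fun k : ℕ ↦
      delCoeff f (n, k) * Real.exp (-(delFreq f (n, k) * 2)) := fun n ↦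
    (hgeo.mul_left (q n)).of_nonneg_of_le (fun k ↦ hF0 (n, k)) (hterm n)
  -- the outer sum: `∑_k F(n,k) ≤ q n * 4/3`, and `∑_n q n < ∞`
  have hq_summ : Summable q := by
    have h := (summable_ratPrimes_prime_rpow (σ := 2) (by norm_num)).subtype (Set.range f)ᶜ
    refine h.congr fun n ↦ ?_
    simp only [Function.comp_apply, ratPrimes_prime, hq]
    rw [Real.rpow_def_of_pos (by exact_mod_cast (prime_ratPrime (n : ℕ)).pos)]
    congr 1
    ring
  have houter : Summable fun n : ↥(Set.range f)ᶜ ↦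
      ∑' k : ℕ, delCoeff f (n, k) * Real.exp (-(delFreq f (n, k) * 2)) := by
    refine (hq_summ.mul_right (∑' k : ℕ, (1 / 4 : ℝ) ^ k)).of_nonneg_of_le
      (fun n ↦ tsum_nonneg fun k ↦ hF0 (n, k)) fun n ↦ ?_
    calc ∑' k : ℕ, delCoeff f (n, k) * Real.exp (-(delFreq f (n, k) * 2))
        ≤ ∑' k : ℕ, q n * (1 / 4 : ℝ) ^ k :=
          (hinner n).tsum_le_tsum (hterm n) (hgeo.mul_left (q n))
      _ = q n * ∑' k : ℕ, (1 / 4 : ℝ) ^ k := tsum_mul_left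
  exact (summable_prod_of_nonneg hF0).2 ⟨hinner, houter⟩

/-- `∑_{k ≥ 1} p^{−ks}/k = −log(1 − p^{−s})`, in the `genDirichlet` normal form.
[cite: MontgomeryVaughan2007, §1.3, display after Cor. 1.10 (held PDF p. 30)] -/
theorem hasSum_delTerm {p : ℝ} (hp : 1 < p) {s : ℂ} (hs : 0 < s.re) :
    HasSum (fun k : ℕ ↦ (((1 / ((k : ℝ) + 1) : ℝ)) : ℂ) *
        Complex.exp (-((((k : ℝ) + 1) * Real.log p : ℝ) : ℂ) * s))
      (-Complex.log (1 - (p : ℂ) ^ (-s))) := by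
  have hp0 : (0 : ℝ) < p := by linarith
  set w : ℂ := (p : ℂ) ^ (-s) with hw
  have hwn : ‖w‖ < 1 := by
    rw [hw, Complex.norm_cpow_eq_rpow_re_of_pos hp0, neg_re]
    exact Real.rpow_lt_one_of_one_lt_of_neg hp (by linarith)
  have h := (hasSum_nat_add_iff' 1).2 (Complex.hasSum_taylorSeries_neg_log hwn)
  simp only [Finset.sum_range_one, pow_zero, Nat.cast_zero, div_zero, sub_zero] at h
  refine h.congr_fun fun k ↦ ?_
  -- `w^(k+1)/(k+1) = (1/(k+1)) e^{−(k+1) log p · s}`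
  have hwexp : w = Complex.exp ((Real.log p : ℂ) * -s) := by
    rw [hw, Complex.cpow_def_of_ne_zero (by exact_mod_cast hp0.ne'), ← Complex.ofReal_log hp0.le]
  rw [hwexp, ← Complex.exp_nat_mul]
  push_cast
  rw [show (((k : ℂ) + 1) * ((Real.log p : ℂ) * -s)) = -(((k : ℂ) + 1) * (Real.log p : ℂ)) * s by ring]
  ring

variable {f}

/-- The deleted Euler logarithm `G_D(s) = ∑_{p deleted} −log(1 − p^{−s})` IS the generalized Dirichlet series
`genDirichlet (delCoeff f) (delFreq f)` on `Re s > 2`. [cite: MontgomeryVaughan2007, §1.3, display after Cor. 1.10 (held PDF p. 30)] -/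
theorem genDirichlet_del_eq {s : ℂ} (hs : 2 < s.re) :
    Landau.genDirichlet (delCoeff f) (delFreq f) s =
      ∑' n : ↥(Set.range f)ᶜ, -Complex.log (1 - ((ratPrime (n : ℕ) : ℝ) : ℂ) ^ (-s)) := by
  have hsum : Summable fun i : ↥(Set.range f)ᶜ × ℕ ↦
      ((delCoeff f i : ℝ) : ℂ) * Complex.exp (-((delFreq f i : ℝ) : ℂ) * s) := by
    have h := Landau.summable_dirichletTerm (delCoeff_nonneg f) (delFreq_nonneg f)
      (summable_del_two f) 0 hs
    refine h.congr fun i ↦ ?_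
    simp [Landau.dirichletTerm]
  unfold Landau.genDirichlet
  rw [hsum.tsum_prod]
  refine tsum_congr fun n ↦ ?_
  have h := hasSum_delTerm (one_lt_ratPrime_real (n : ℕ)) (s := s) (by linarith)
  simp only [delCoeff, delFreq]
  exact h.tsum_eq

/-- **`ζ_P / ζ = exp(−G_D)`** on `Re s > 2` for a sub-sequence `P` of ℙ (`λ_j = q_{f j}`, `f` strictly
increasing): `log ζ(s) = ∑_p log(1 − p^{−s})^{−1} = ∑_p ∑_k k^{−1} p^{−ks}`, split over kept and deleted primes.
[cite: MontgomeryVaughan2007, §1.3, display after Cor. 1.10 (held PDF p. 30)] -/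
theorem zeta_div_riemannZeta_eq {P : BeurlingPrimes} (hf : StrictMono f)
    (hP : ∀ j : ℕ, P.prime j = (ratPrime (f j) : ℝ)) {s : ℂ} (hs : 2 < s.re) :
    P.zeta s / riemannZeta s =
      Complex.exp (-Landau.genDirichlet (delCoeff f) (delFreq f) s) := by
  have hs0 : 0 < s.re := by linarith
  have hs1 : 1 < s.re := by linarith
  -- the Euler logarithm terms of ℙ
  set T : ℕ → ℂ := fun n ↦ Complex.log ((1 - ((ratPrime n : ℝ) : ℂ) ^ (-s))⁻¹) with hT
  have hsumQ : Summable fun j ↦ ratPrimes.prime j ^ (-s.re) := summable_ratPrimes_prime_rpow hs1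
  have hTsum : Summable T := by
    have := ratPrimes.summable_log_eulerFactor hs0 hsumQ
    simpa [hT, ratPrimes_prime] using this
  have hsumP : Summable fun j ↦ P.prime j ^ (-s.re) := by
    have := hsumQ.comp_injective hf.injective
    refine this.congr fun j ↦ ?_
    simp [Function.comp_apply, hP]
  -- `ζ_P = exp(∑_j T (f j))`, `ζ = exp(∑_n T n)`
  have hZP : P.zeta s = Complex.exp (∑' j, T (f j)) := by
    rw [P.zeta_eq_exp_tsum hs0 hsumP]
    congr 1
    refine tsum_congr fun j ↦ ?_
    simp [hT, hP]
  have hZQ : riemannZeta s = Complex.exp (∑' n, T n) := by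
    rw [← zeta_ratPrimes hs1, ratPrimes.zeta_eq_exp_tsum hs0 hsumQ]
    congr 1
  -- split `∑_n T n` over kept and deleted indices
  have hsplit : ∑' n, T n = ∑' j, T (f j) + ∑' n : ↥(Set.range f)ᶜ, T n := by
    have h0 : ∑' n : ↥(Set.range f), T n + ∑' n : ↥(Set.range f)ᶜ, T n = ∑' n, T n :=
      (hTsum.subtype _).tsum_add_tsum_compl (hTsum.subtype _)
    have h1 : ∑' n : ↥(Set.range f), T n = ∑' j, T (f j) := tsum_range T hf.injective
    rw [← h0, h1]
  -- the deleted part is `G_D`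
  have hdel : ∑' n : ↥(Set.range f)ᶜ, T n = Landau.genDirichlet (delCoeff f) (delFreq f) s := by
    rw [genDirichlet_del_eq hs]
    refine tsum_congr fun n ↦ ?_
    simp only [hT]
    refine log_inv_one_sub ?_
    rw [Complex.norm_cpow_eq_rpow_re_of_pos (by exact_mod_cast (prime_ratPrime (n : ℕ)).pos), neg_re]
    exact Real.rpow_lt_one_of_one_lt_of_neg (one_lt_ratPrime_real _) (by linarith)
  rw [hZP, hZQ, hsplit, hdel, ← Complex.exp_sub]
  congr 1
  ring

end DeletedLog

/-! ## The barrier statement and its proof -/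

/-- **Real-zero dominance for pure deletions (the Landau positivity law of S3♯).** In the RH world, for every
multiplicity-one sub-sequence `P` of ℙ with `N_P(x) = a x + O(x^θ)`, `a > 0`, `θ < 1/2`, and a continuation `Z` of `ζ_P`
to `{Re s > θ} ∖ {1}`: every zero `ρ` of `Z` with `1/2 < Re ρ < 1` is dominated by a REAL zero `β ∈ [Re ρ, 1)` of `Z`.
(An implication FROM RH; proved below, `subPrimeRealZeroDominance_holds`.) [cite: MontgomeryVaughan2007, §1.2 Thm. 1.7 (proof)] -/
def SubPrimeRealZeroDominance : Prop :=
  RiemannHypothesis → ∀ (P : BeurlingPrimes) (f : ℕ → ℕ) (a θ : ℝ) (Z : ℂ → ℂ), StrictMono f →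
    (∀ j : ℕ, P.prime j = (ratPrime (f j) : ℝ)) → 0 < a → θ < 1 / 2 → P.IntErrorLE a θ →
    P.IsZetaContinuation θ Z →
    ∀ ρ : ℂ, 1 / 2 < ρ.re → ρ.re < 1 → Z ρ = 0 → ∃ β : ℝ, ρ.re ≤ β ∧ β < 1 ∧ Z β = 0

/-- **Real-zero dominance holds** (RH ⇒ `Z/ζ = exp(−G_D)` with `G_D ≥ 0`-coefficient generalized Dirichlet series;
Landau). [cite: MontgomeryVaughan2007, §1.2 Thm. 1.7 (proof)] -/
theorem subPrimeRealZeroDominance_holds : SubPrimeRealZeroDominance := by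
  intro hRH P f a θ Z hf hP ha hθ hN hZ ρ hρlo hρhi hZρ
  have hθ1 : θ < 1 := by linarith
  obtain ⟨hsumP, Z₀, hZ₀, ⟨E₀, hE₀, hZ₀E⟩, -, -⟩ :=
    MontgomeryVaughan2007_zetaContinuation_holds P a θ ha hθ1 hN
  have heq : EqOn Z Z₀ {s : ℂ | θ < s.re ∧ s ≠ 1} := hZ.eqOn hZ₀
  have hZform : ∀ s : ℂ, θ < s.re → s ≠ 1 → Z s = a * s / (s - 1) + E₀ s :=
    fun s hs hs1 ↦ (heq ⟨hs, hs1⟩).trans (hZ₀E s hs hs1)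
  -- RH: `ζ ≠ 0` on `Re s > 1/2`
  have hζne : ∀ s : ℂ, 1 / 2 < s.re → riemannZeta s ≠ 0 := fun s hs ↦
    riemannZeta_ne_zero_of_riemannHypothesis hRH (by linarith) (by linarith)
  -- the quotient `E = Z/ζ`, value `a` at `1`
  set Eq : ℂ → ℂ := Function.update (fun s ↦ Z s / riemannZeta s) 1 (a : ℂ) with hEq
  have hEq_ne : ∀ s : ℂ, s ≠ 1 → Eq s = Z s / riemannZeta s := fun s hs ↦ by
    rw [hEq, Function.update_of_ne hs]
  have hEq_one : Eq 1 = a := by rw [hEq, Function.update_self]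
  have hOθ : IsOpen {s : ℂ | θ < s.re ∧ s ≠ 1} :=
    (isOpen_lt continuous_const Complex.continuous_re).inter isOpen_ne
  have hO : IsOpen {s : ℂ | 1 / 2 < s.re} := isOpen_lt continuous_const Complex.continuous_re
  -- holomorphy off `1`
  have hdiff' : DifferentiableOn ℂ Eq ({s : ℂ | 1 / 2 < s.re} \ {1}) := by
    have h1 : DifferentiableOn ℂ (fun s ↦ Z s / riemannZeta s) ({s : ℂ | 1 / 2 < s.re} \ {1}) := by
      intro s hs
      have hs1 : (1 : ℝ) / 2 < s.re := hs.1
      have hs2 : s ≠ 1 := hs.2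
      have hZd : DifferentiableAt ℂ Z s :=
        hZ.2.differentiableAt (hOθ.mem_nhds ⟨(by linarith : θ < s.re), hs2⟩)
      exact (hZd.div (differentiableAt_riemannZeta hs2) (hζne s hs1)).differentiableWithinAt
    exact h1.congr fun s hs ↦ hEq_ne s hs.2
  -- continuity at `1`: `(s−1)Z(s) → a`, `(s−1)ζ(s) → 1`
  have hcont : ContinuousAt Eq 1 := by
    rw [hEq, continuousAt_update_same]
    have hE₀c : ContinuousAt E₀ 1 :=
      (hE₀.differentiableAt ((isOpen_lt continuous_const Complex.continuous_re).mem_nhds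
        (by simp only [Set.mem_setOf_eq, one_re]; linarith))).continuousAt
    have h2 : Tendsto (fun s : ℂ ↦ (a : ℂ) * s + (s - 1) * E₀ s) (𝓝 1)
        (𝓝 ((a : ℂ) * 1 + (1 - 1) * E₀ 1)) :=
      (tendsto_const_nhds.mul tendsto_id).add ((tendsto_id.sub tendsto_const_nhds).mul hE₀c.tendsto)
    rw [mul_one, sub_self, zero_mul, add_zero] at h2
    have hnear : ∀ᶠ s in 𝓝[≠] (1 : ℂ), θ < s.re ∧ s ≠ 1 := by
      have h1 : ∀ᶠ s in 𝓝 (1 : ℂ), θ < s.re :=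
        (isOpen_lt continuous_const Complex.continuous_re).mem_nhds
          (by simp only [Set.mem_setOf_eq, one_re]; linarith)
      exact (h1.filter_mono nhdsWithin_le_nhds).and self_mem_nhdsWithin
    have hnum : Tendsto (fun s ↦ (s - 1) * Z s) (𝓝[≠] 1) (𝓝 (a : ℂ)) := by
      refine (h2.mono_left nhdsWithin_le_nhds).congr' ?_
      filter_upwards [hnear] with s hs
      rw [hZform s hs.1 hs.2]
      have : s - 1 ≠ 0 := sub_ne_zero.2 hs.2
      field_simp
    have hq := hnum.div riemannZeta_residue_one one_ne_zero
    rw [div_one] at hq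
    refine hq.congr' ?_
    filter_upwards [self_mem_nhdsWithin] with s hs
    exact mul_div_mul_left _ _ (sub_ne_zero.2 hs)
  have hEqd : DifferentiableOn ℂ Eq {s : ℂ | 1 / 2 < s.re} :=
    (Complex.differentiableOn_compl_singleton_and_continuousAt_iff
      (hO.mem_nhds (by simp only [Set.mem_setOf_eq, one_re]; norm_num))).1 ⟨hdiff', hcont⟩
  -- agreement with `exp(−G_D)` far to the right
  have hagree : EqOn Eq (fun s ↦ Complex.exp (-Landau.genDirichlet (delCoeff f) (delFreq f) s))
      {s : ℂ | 2 < s.re} := by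
    intro s hs
    have hs' : (2 : ℝ) < s.re := hs
    have hs1 : s ≠ 1 := fun h ↦ by rw [h, one_re] at hs'; linarith
    show Eq s = _
    rw [hEq_ne s hs1, hZ.1 s (by linarith)]
    exact zeta_div_riemannZeta_eq hf hP hs'
  -- the core lemma
  have hρ1 : ρ ≠ 1 := fun h ↦ by rw [h, one_re] at hρhi; exact lt_irrefl _ hρhi
  have hEρ : Eq ρ = 0 := by rw [hEq_ne ρ hρ1, hZρ, zero_div]
  obtain ⟨β, hρβ, -, hEβ, -⟩ := Landau.exists_real_zero_of_eqOn_cexp_neg (delCoeff_nonneg f)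
    (delFreq_nonneg f) (summable_del_two f) hEqd hagree (η := 1 / 2) hρlo hEρ
  have hβhalf : 1 / 2 < β := lt_of_lt_of_le hρlo hρβ
  have hβ1 : (β : ℂ) ≠ 1 := by
    intro h
    have h0 : Eq 1 = 0 := by rw [← h]; exact hEβ
    rw [hEq_one] at h0
    exact ha.ne' (by exact_mod_cast h0)
  have hZβ : Z β = 0 := by
    have h0 := hEβ
    rw [hEq_ne _ hβ1, div_eq_zero_iff] at h0
    exact h0.resolve_right (hζne _ (by simpa using hβhalf))
  have hβlt : β < 1 := by
    by_contra h
    push Not at h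
    have hβne : β ≠ 1 := fun h' ↦ hβ1 (by rw [h']; simp)
    have hβ1' : 1 < β := lt_of_le_of_ne h (Ne.symm hβne)
    have h1 : Z β = P.zeta β := hZ.1 _ (by simpa using hβ1')
    refine P.zeta_ne_zero (s := (β : ℂ)) (by simp only [ofReal_re]; linarith) ?_ (h1 ▸ hZβ)
    simpa using hsumP β hβ1'
  exact ⟨β, hρβ, hβlt, hZβ⟩

/-- `SubPrimeRealZeroDominance` — `_holds` alias of `subPrimeRealZeroDominance_holds` above under the fact's exact name (appended
2026-08-28, D-0026 bookkeeping: the proof term is the existing theorem of this file; no statement,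
definition or attribute is edited; no new named fact; the ledger's debt table listed the fact
unproved). [cite: MontgomeryVaughan2007, §1.2 Thm. 1.7 (proof)] -/
theorem _root_.Literature.Barriers.RiemannHypothesis.SubPrimeRealZeroDominance_holds :
    SubPrimeRealZeroDominance :=
  _root_.Literature.Barriers.RiemannHypothesis.subPrimeRealZeroDominance_holds


/-! ## The barrier class and the two bookends -/

/-- The witness class an S3-type barrier against REAL-ZERO-FREE criteria would need at window `θ`: a multiplicity-one
sub-sequence of ℙ with `N_P(x) = a x + O(x^θ)`, `a > 0`, a continuation `Z` of `ζ_P` to `{Re s > θ} ∖ {1}`, NO real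
zero of `Z` in `(1/2, 1)`, and yet a zero of `Z` with `1/2 < Re s < 1` (the witness class of the parent record S3♯, plus
real-zero-freeness). [cite: BrouckeDebruyneRevesz2023, §5 pp. 15–17] -/
def SubPrimeBlindRealZeroFree (θ : ℝ) : Prop :=
  ∃ (P : BeurlingPrimes) (f : ℕ → ℕ) (a : ℝ) (Z : ℂ → ℂ) (ρ : ℂ),
    StrictMono f ∧ (∀ j : ℕ, P.prime j = (ratPrime (f j) : ℝ)) ∧ 0 < a ∧ P.IntErrorLE a θ ∧
    P.IsZetaContinuation θ Z ∧ (∀ σ : ℝ, 1 / 2 < σ → σ < 1 → Z σ ≠ 0) ∧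
    1 / 2 < ρ.re ∧ ρ.re < 1 ∧ Z ρ = 0

/-- **Bookend 1.** If RH fails, `ℙ` itself is such a witness at every window `θ ≥ 0` (`ζ(σ) ≠ 0` on `(0,1)`:
`riemannZeta_ofReal_ne_zero_of_pos_of_lt_one`). [cite: MontgomeryVaughan2007, §1.3 Cor. 1.14 (held PDF p. 31)] -/
theorem subPrimeBlindRealZeroFree_of_not_riemannHypothesis (hRH : ¬ RiemannHypothesis) {θ : ℝ} (hθ : 0 ≤ θ) :
    SubPrimeBlindRealZeroFree θ := by
  obtain ⟨ρ, hζ, h0, hhalf⟩ := exists_zero_half_lt_re_of_not_riemannHypothesis hRH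
  have hρ1 : ρ.re < 1 := by
    by_contra h
    exact riemannZeta_ne_zero_of_one_le_re (not_lt.1 h) hζ
  refine ⟨ratPrimes, id, 1, riemannZeta, ρ, strictMono_id, fun j ↦ rfl, one_pos, ratPrimes_intErrorLE hθ, ?_,
    fun σ h0σ hσ1 ↦ riemannZeta_ofReal_ne_zero_of_pos_of_lt_one σ (by linarith) hσ1, hhalf, hρ1, hζ⟩
  exact (BeurlingPrimes.isZetaContinuation_iff _ _ _).2
    ⟨fun s hs ↦ (zeta_ratPrimes hs).symm, fun s hs ↦ (differentiableAt_riemannZeta hs.2).differentiableWithinAt⟩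

/-- **Bookend 2.** Under RH there is NO such witness at any window `θ < 1/2` (real-zero dominance).
[cite: MontgomeryVaughan2007, §1.2 Thm. 1.7 (proof)] -/
theorem not_subPrimeBlindRealZeroFree_of_riemannHypothesis (hRH : RiemannHypothesis) {θ : ℝ} (hθ : θ < 1 / 2) :
    ¬ SubPrimeBlindRealZeroFree θ := by
  rintro ⟨P, f, a, Z, ρ, hf, hP, ha, hN, hZ, hreal, hlo, hhi, hρ⟩
  obtain ⟨β, hβlo, hβhi, hβ⟩ := subPrimeRealZeroDominance_holds hRH P f a θ Z hf hP ha hθ hN hZ ρ hlo hhi hρ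
  exact hreal β (lt_of_lt_of_le hlo hβlo) hβhi hβ

/-- **The barrier sentence.** An S3-type (sub-ℙ deletion) barrier against REAL-ZERO-FREE criteria at a window
`θ ∈ [0, 1/2)` exists if and only if RH fails. [cite: MontgomeryVaughan2007, §1.2 Thm. 1.7 (proof)] -/
theorem subPrimeBlindRealZeroFree_iff_not_riemannHypothesis {θ : ℝ} (hθ0 : 0 ≤ θ) (hθ : θ < 1 / 2) :
    SubPrimeBlindRealZeroFree θ ↔ ¬ RiemannHypothesis :=
  ⟨fun h hRH ↦ not_subPrimeBlindRealZeroFree_of_riemannHypothesis hRH hθ h,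
    fun hRH ↦ subPrimeBlindRealZeroFree_of_not_riemannHypothesis hRH hθ0⟩

/-- **No deletion witness against real-zero-free criteria (the priced class, RH-free reading).** A would-be criterion
«multiplicity-one sub-ℙ support + `N_P(x) = ax + O(x^θ)` (`0 ≤ θ < 1/2`) + continuation to `Re s > θ` + no real zero on
`(1/2,1)` ⟹ no zero in `1/2 < Re s < 1`» has a counterexample iff RH fails; equivalently it HOLDS iff RH holds.
[cite: MontgomeryVaughan2007, §1.2 Thm. 1.7 (proof)] -/
theorem subPrimeRealZeroFreeCriterion_iff_riemannHypothesis {θ : ℝ} (hθ0 : 0 ≤ θ) (hθ : θ < 1 / 2) :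
    (∀ (P : BeurlingPrimes) (f : ℕ → ℕ) (a : ℝ) (Z : ℂ → ℂ), StrictMono f →
        (∀ j : ℕ, P.prime j = (ratPrime (f j) : ℝ)) → 0 < a → P.IntErrorLE a θ → P.IsZetaContinuation θ Z →
        (∀ σ : ℝ, 1 / 2 < σ → σ < 1 → Z σ ≠ 0) → ∀ s : ℂ, 1 / 2 < s.re → s.re < 1 → Z s ≠ 0) ↔
      RiemannHypothesis := by
  constructor
  · intro h
    by_contra hRH
    obtain ⟨P, f, a, Z, ρ, hf, hP, ha, hN, hZ, hreal, hlo, hhi, hρ⟩ :=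
      subPrimeBlindRealZeroFree_of_not_riemannHypothesis hRH hθ0
    exact h P f a Z hf hP ha hN hZ hreal ρ hlo hhi hρ
  · intro hRH P f a Z hf hP ha hN hZ hreal s hlo hhi hs
    exact not_subPrimeBlindRealZeroFree_of_riemannHypothesis hRH hθ
      ⟨P, f, a, Z, s, hf, hP, ha, hN, hZ, hreal, hlo, hhi, hs⟩

end Literature.Barriers.RiemannHypothesis
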